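import Literature.Probability.RandomGraphs.PlantedCliqueRecovery
import Literature.Probability.RandomGraphs.PlantedCliqueUnique
import HarnessLib

/-!
# Planted clique: the AKS program succeeds with probability tending to one

For a planted set `S` of size `k`, a seed `S'₀ ⊆ S` of size `s` and the uniformly random remainder
`x`, the AKS program `AKSProg.output s` fails to return `S` only on the union of the four bad
events of the analysis (not the unique maximum clique, bad degrees, bad norm, bad size), provided
the numeric side conditions `64 (12 √(κ + 2n/2ˢ) + 1) ≤ κ` and `32 √κ ≤ 2ⁿ` hold (`κ = k - s`):
`failAt_subset`, `card_failAt_le`. Consequently, under `G(n, 1/2, k)` (`plantedCliqueJoint n k`)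
the program fails with probability at most
`n³ 2^{-⌊(k-1)/2⌋} + n e^{-κ/72} + e^{-4κ} + 2ˢ/n` (`toOuterMeasure_fail_le`).

The limit form (`tendsto_success`): for `c > 0`, a seed half-length `j` with `5000/c ≤ 2ʲ` (seed
length `s = 2j`, AKS's `s = 2⌈log₂(10/c)⌉ + 2` with our constants) and any clique-size sequence
`k` with `c √n ≤ k n ≤ n` eventually, the program `AKSProg.output (2j)` recovers the planted set
of `G(n, 1/2, k n)` with probability `→ 1`. Ingredients: the numeric side conditions hold
eventually, uniformly in `k ∈ [c√n, n]` (`numeric_eventually`), and the error terms tend to `0`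
(`tendsto_errBound`). This is the quantitative content of Alon–Krivelevich–Sudakov 1998,
§2.2–2.3 ("for any fixed `c` Algorithm B almost surely produces the hidden clique"); the machine
and the discharge of `aks_recovery` are assembled in `PlantedCliqueFactsProofs.lean`.

The events `failAt(n, s, S)`, `notUniqueAt(S)` and the error term `errBound(n, k, s)` are local
notations, not declarations: this file introduces no definitions and no named facts.

## References

* N. Alon, M. Krivelevich, B. Sudakov, *Finding a large hidden clique in a random graph*, Random
  Structures Algorithms 13 (1998) 457–466, §2.2–2.3 [AlonKrivelevichSudakov1998].
-/

noncomputable section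

open Finset Filter
open scoped ENNReal Topology

namespace Literature.Probability.RandomGraphs.PlantedClique

variable {n : ℕ}

/-! ### Failure at a fixed planted set is covered by the bad events -/

/-- Notation (local, not a declaration): `failAt(n, s, S)`, the failure event of the program
(seed length `s`) at the planted set `S`. -/
local notation3 (prettyPrint := false) "failAt(" n ", " s ", " S ")" =>
  Finset.filter (fun x : EdgeVec n =>
    decodeVertexSet n (AKSProg.output s (n, encodeEdgeVec (plant S x))) ≠ S) Finset.univ

/-- Notation (local, not a declaration): `notUniqueAt(S)`, the non-uniqueness event at the planted
set `S` (classically decidable). -/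
local notation3 (prettyPrint := false) "notUniqueAt(" S ")" =>
  @Finset.filter (EdgeVec _) (fun x => ¬ IsUniqueMaxClique (graphOfEdgeVec (plant S x)) S)
    (fun _ => @instDecidableNot _ (Classical.propDecidable _)) Finset.univ

/-- **Failure is covered by the four bad events** (contrapositive of
`AKSProg.decodeVertexSet_output_eq`, with `|seedNbhd| = κ + outsideNbrCount < κ + 2n/2ˢ` off the
bad size event). [cite: AlonKrivelevichSudakov1998, §2.3 (correctness of Algorithm B)] -/
theorem failAt_subset {S S'₀ : Finset (Fin n)} (hS'S : S'₀ ⊆ S) {s : ℕ} (hs : S'₀.card = s)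
    (hnum : 64 * (12 * Real.sqrt ((S \ S'₀).card + 2 * n / 2 ^ s) + 1) ≤ ((S \ S'₀).card : ℝ))
    (ht : 32 * Real.sqrt (S \ S'₀).card ≤ (2 : ℝ) ^ n) :
    failAt(n, s, S) ⊆ notUniqueAt(S) ∪ badDeg S (S \ S'₀) ∪ badNorm S S'₀ ∪ badSize S S'₀ := by
  classical
  intro x hx
  rw [mem_filter] at hx
  by_contra hgood
  simp only [mem_union, not_or] at hgood
  obtain ⟨⟨⟨hU, hdeg⟩, hnorm⟩, hsize⟩ := hgood
  apply hx.2
  rw [← hs]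
  refine AKSProg.decodeVertexSet_output_eq hS'S ?_ hdeg ?_ ?_ ht
  · simp only [Finset.mem_filter, Finset.mem_univ, true_and, not_not] at hU
    exact hU
  · rw [badNorm, mem_filter, not_and] at hnorm
    exact hnorm (mem_univ _)
  · refine le_trans ?_ hnum
    have hm : ((seedNbhd S S'₀ x).card : ℝ) ≤ (S \ S'₀).card + 2 * n / 2 ^ s := by
      rw [card_seedNbhd hS'S, Nat.cast_add, ← hs]
      rw [mem_badSize, not_le] at hsize
      linarith
    gcongr

/-- Failure at `S` counted: `#failAt ≤ #notUnique + #badDeg + #badNorm + #badSize`. [folklore] -/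
theorem card_failAt_le {S S'₀ : Finset (Fin n)} (hS'S : S'₀ ⊆ S) {s : ℕ} (hs : S'₀.card = s)
    (hnum : 64 * (12 * Real.sqrt ((S \ S'₀).card + 2 * n / 2 ^ s) + 1) ≤ ((S \ S'₀).card : ℝ))
    (ht : 32 * Real.sqrt (S \ S'₀).card ≤ (2 : ℝ) ^ n) :
    (failAt(n, s, S)).card ≤ (notUniqueAt(S)).card + (badDeg S (S \ S'₀)).card + (badNorm S S'₀).card +
      (badSize S S'₀).card :=
  calc (failAt(n, s, S)).card
      ≤ (notUniqueAt(S) ∪ badDeg S (S \ S'₀) ∪ badNorm S S'₀ ∪ badSize S S'₀).card :=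
        card_le_card (failAt_subset hS'S hs hnum ht)
    _ ≤ (notUniqueAt(S) ∪ badDeg S (S \ S'₀) ∪ badNorm S S'₀).card + (badSize S S'₀).card :=
        card_union_le _ _
    _ ≤ (notUniqueAt(S) ∪ badDeg S (S \ S'₀)).card + (badNorm S S'₀).card + (badSize S S'₀).card :=
        Nat.add_le_add_right (card_union_le _ _) _
    _ ≤ (notUniqueAt(S)).card + (badDeg S (S \ S'₀)).card + (badNorm S S'₀).card + (badSize S S'₀).card :=
        Nat.add_le_add_right (Nat.add_le_add_right (card_union_le _ _) _) _

/-! ### From counts to probabilities -/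

/-- The uniform probability of a finite event on the cube is its cardinality over `2^{#E}`.
[folklore] -/
theorem toOuterMeasure_erdosRenyiHalf_finset (B : Finset (EdgeVec n)) :
    (erdosRenyiHalf n).toOuterMeasure ↑B =
      (B.card : ℝ≥0∞) / 2 ^ Fintype.card (⊤ : SimpleGraph (Fin n)).edgeSet := by
  classical
  rw [erdosRenyiHalf, PMF.uniformOfFintype, PMF.toOuterMeasure_uniformOfFinset_apply]
  have hU : (((univ : Finset (EdgeVec n)).card : ℕ) : ℝ≥0∞) =
      2 ^ Fintype.card (⊤ : SimpleGraph (Fin n)).edgeSet := by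
    rw [card_univ, Fintype.card_fun, Fintype.card_bool]; push_cast; rfl
  have key : ∀ N : ℕ, N = B.card →
      (N : ℝ≥0∞) / ((univ : Finset (EdgeVec n)).card : ℕ) =
        (B.card : ℝ≥0∞) / 2 ^ Fintype.card (⊤ : SimpleGraph (Fin n)).edgeSet := by
    rintro N rfl; rw [hU]
  refine key _ ?_
  congr 1
  ext x
  simp

/-- A count `#B ≤ r · 2^{#E}` is a probability `≤ r`. [folklore] -/
theorem toOuterMeasure_finset_le_ofReal {B : Finset (EdgeVec n)} {r : ℝ} (hr : 0 ≤ r)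
    (h : (B.card : ℝ) ≤ r * 2 ^ Fintype.card (⊤ : SimpleGraph (Fin n)).edgeSet) :
    (erdosRenyiHalf n).toOuterMeasure ↑B ≤ ENNReal.ofReal r := by
  rw [toOuterMeasure_erdosRenyiHalf_finset]
  have h2 : (2 : ℝ≥0∞) ^ Fintype.card (⊤ : SimpleGraph (Fin n)).edgeSet ≠ 0 := pow_ne_zero _ two_ne_zero
  have h2' : (2 : ℝ≥0∞) ^ Fintype.card (⊤ : SimpleGraph (Fin n)).edgeSet ≠ ∞ :=
    ENNReal.pow_ne_top ENNReal.ofNat_ne_top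
  rw [ENNReal.div_le_iff h2 h2']
  have : ((B.card : ℝ≥0∞)) = ENNReal.ofReal (B.card : ℝ) := by rw [ENNReal.ofReal_natCast]
  rw [this, show (2 : ℝ≥0∞) ^ Fintype.card (⊤ : SimpleGraph (Fin n)).edgeSet =
    ENNReal.ofReal ((2 : ℝ) ^ Fintype.card (⊤ : SimpleGraph (Fin n)).edgeSet) by
      rw [ENNReal.ofReal_pow (by norm_num), ENNReal.ofReal_ofNat], ← ENNReal.ofReal_mul hr]
  exact ENNReal.ofReal_le_ofReal h

/-- Notation (local, not a declaration): `errBound(n, k, s)`, the three probabilistic error terms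
at clique size `k`, seed length `s`, `κ = k - s`: `n e^{-κ/72} + e^{-4κ} + 2ˢ/n`
[AlonKrivelevichSudakov1998, §2.2–2.3]. -/
local notation3 (prettyPrint := false) "errBound(" n ", " k ", " s ")" =>
  ((n : ℕ) * Real.exp (-(((k : ℕ) - (s : ℕ) : ℕ) / 72 : ℝ)) +
    Real.exp (-(4 * (((k : ℕ) - (s : ℕ) : ℕ) : ℝ))) + (2 : ℝ) ^ (s : ℕ) / (n : ℕ) : ℝ)

/-- `errBound` is nonnegative. [folklore] -/
theorem errBound_nonneg (n k s : ℕ) : 0 ≤ errBound(n, k, s) := by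
  positivity

/-- **Failure probability at a fixed planted set.** For `|S| = k`, a seed `S'₀ ⊆ S` of size `s`
with `1 ≤ k - s`, `1 ≤ n`, and the numeric side conditions, the program fails at `S` with
probability at most `n³ 2^{-⌊(k-1)/2⌋} + errBound(n, k, s)`.
[cite: AlonKrivelevichSudakov1998, §2.2–2.3 (Algorithm B almost surely produces the hidden clique)] -/
theorem toOuterMeasure_failAt_le {S S'₀ : Finset (Fin n)} (hS'S : S'₀ ⊆ S) {k s : ℕ}
    (hSk : S.card = k) (hs : S'₀.card = s) (hκ : 1 ≤ k - s) (hn : 1 ≤ n) (hkn : k ≤ n)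
    (hnum : 64 * (12 * Real.sqrt ((k - s : ℕ) + 2 * n / 2 ^ s) + 1) ≤ ((k - s : ℕ) : ℝ))
    (ht : 32 * Real.sqrt (k - s : ℕ) ≤ (2 : ℝ) ^ n) :
    (erdosRenyiHalf n).toOuterMeasure ↑(failAt(n, s, S)) ≤
      (n : ℝ≥0∞) ^ 3 * 2⁻¹ ^ ((k - 1) / 2) + ENNReal.ofReal (errBound(n, k, s)) := by
  classical
  have hκeq : (S \ S'₀).card = k - s := by rw [card_sdiff_of_subset hS'S, hSk, hs]
  have hk1 : 1 ≤ k := hκ.trans (Nat.sub_le _ _)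
  rw [← hκeq] at hnum ht hκ
  have hsub := failAt_subset hS'S hs hnum ht
  calc (erdosRenyiHalf n).toOuterMeasure ↑(failAt(n, s, S))
      ≤ (erdosRenyiHalf n).toOuterMeasure
          ↑(notUniqueAt(S) ∪ badDeg S (S \ S'₀) ∪ badNorm S S'₀ ∪ badSize S S'₀) :=
        (erdosRenyiHalf n).toOuterMeasure.mono (by exact_mod_cast hsub)
    _ ≤ (erdosRenyiHalf n).toOuterMeasure ↑(notUniqueAt(S)) +
          (erdosRenyiHalf n).toOuterMeasure ↑(badDeg S (S \ S'₀) ∪ badNorm S S'₀ ∪ badSize S S'₀) := by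
        rw [show (↑(notUniqueAt(S) ∪ badDeg S (S \ S'₀) ∪ badNorm S S'₀ ∪ badSize S S'₀) : Set (EdgeVec n))
          = ↑(notUniqueAt(S)) ∪ ↑(badDeg S (S \ S'₀) ∪ badNorm S S'₀ ∪ badSize S S'₀) by
            push_cast; simp only [Set.union_assoc]]
        exact MeasureTheory.measure_union_le _ _
    _ ≤ (n : ℝ≥0∞) ^ 3 * 2⁻¹ ^ ((k - 1) / 2) + ENNReal.ofReal (errBound(n, k, s)) := by
        gcongr
        · have h := toOuterMeasure_not_isUniqueMaxClique_plant_le (n := n) hk1 hkn hSk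
          refine le_trans (le_of_eq ?_) h
          congr 1
          ext x; simp
        · refine toOuterMeasure_finset_le_ofReal (errBound_nonneg n k s) ?_
          rw [← hκeq]
          have hE : (0 : ℝ) < 2 ^ Fintype.card (⊤ : SimpleGraph (Fin n)).edgeSet := by positivity
          have h1 := card_badDeg_le (sdiff_subset : S \ S'₀ ⊆ S) hκ
          have h2 := card_badNorm_le hS'S hκ
          have h3 := card_badSize_le hS'S hn
          rw [hs] at h3
          calc (((badDeg S (S \ S'₀) ∪ badNorm S S'₀ ∪ badSize S S'₀).card : ℕ) : ℝ)
              ≤ ((badDeg S (S \ S'₀)).card : ℝ) + (badNorm S S'₀).card + (badSize S S'₀).card := by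
                exact_mod_cast (card_union_le _ _).trans (Nat.add_le_add_right (card_union_le _ _) _)
            _ ≤ n * (Real.exp (-((S \ S'₀).card / 72 : ℝ)) * 2 ^ Fintype.card (⊤ : SimpleGraph (Fin n)).edgeSet)
                + Real.exp (-(4 * (S \ S'₀).card)) * 2 ^ Fintype.card (⊤ : SimpleGraph (Fin n)).edgeSet
                + 2 ^ s / n * 2 ^ Fintype.card (⊤ : SimpleGraph (Fin n)).edgeSet := by
                gcongr
            _ = _ := by ring

/-! ### Averaging over the planted set -/

/-- **Failure probability of the AKS program under `G(n, 1/2, k)`** with seed length `s`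
(`s + 1 ≤ k ≤ n`, `1 ≤ n`) and the numeric side conditions: at most
`n³ 2^{-⌊(k-1)/2⌋} + errBound(n, k, s)`. [cite: AlonKrivelevichSudakov1998, §2.2–2.3] -/
theorem toOuterMeasure_fail_le {k s : ℕ} (hsk : s + 1 ≤ k) (hn : 1 ≤ n) (hkn : k ≤ n)
    (hnum : 64 * (12 * Real.sqrt ((k - s : ℕ) + 2 * n / 2 ^ s) + 1) ≤ ((k - s : ℕ) : ℝ))
    (ht : 32 * Real.sqrt (k - s : ℕ) ≤ (2 : ℝ) ^ n) :
    (plantedCliqueJoint n k).toOuterMeasure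
        {p | decodeVertexSet n (AKSProg.output s (n, encodeEdgeVec p.2)) ≠ p.1} ≤
      (n : ℝ≥0∞) ^ 3 * 2⁻¹ ^ ((k - 1) / 2) + ENNReal.ofReal (errBound(n, k, s)) := by
  classical
  rw [plantedCliqueJoint, PMF.toOuterMeasure_bind_apply]
  set u := PMF.uniformOfFinset (kSubsets n k) (kSubsets_nonempty n k) with hu
  calc ∑' S, u S * ((erdosRenyiHalf n).map fun x => (S, plant S x)).toOuterMeasure
          {p | decodeVertexSet n (AKSProg.output s (n, encodeEdgeVec p.2)) ≠ p.1}
      ≤ ∑' S, u S * ((n : ℝ≥0∞) ^ 3 * 2⁻¹ ^ ((k - 1) / 2) + ENNReal.ofReal (errBound(n, k, s))) := by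
        refine ENNReal.tsum_le_tsum fun S => ?_
        by_cases hS : S ∈ kSubsets n k
        · gcongr
          rw [PMF.toOuterMeasure_map_apply]
          have hcard : S.card = k := (card_of_mem_kSubsets hS).trans (min_eq_left hkn)
          obtain ⟨S'₀, hS'S, hs⟩ := Finset.exists_subset_card_eq (s := S) (n := s) (by rw [hcard]; omega)
          have hset : (fun x => (S, plant S x)) ⁻¹'
              {p : Finset (Fin n) × EdgeVec n |
                decodeVertexSet n (AKSProg.output s (n, encodeEdgeVec p.2)) ≠ p.1} = ↑(failAt(n, s, S)) := by
            ext x; simp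
          rw [hset]
          exact toOuterMeasure_failAt_le hS'S hcard hs (by omega) hn hkn hnum ht
        · rw [hu, PMF.uniformOfFinset_apply_of_notMem (kSubsets_nonempty n k) hS, zero_mul, zero_mul]
    _ = (n : ℝ≥0∞) ^ 3 * 2⁻¹ ^ ((k - 1) / 2) + ENNReal.ofReal (errBound(n, k, s)) := by
        rw [ENNReal.tsum_mul_right, PMF.tsum_coe, one_mul]

/-- Complementary form: the success probability is at least `1 -` the failure bound.
[cite: AlonKrivelevichSudakov1998, §2.2–2.3] -/
theorem one_sub_le_toOuterMeasure_success {k s : ℕ} (hsk : s + 1 ≤ k) (hn : 1 ≤ n) (hkn : k ≤ n)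
    (hnum : 64 * (12 * Real.sqrt ((k - s : ℕ) + 2 * n / 2 ^ s) + 1) ≤ ((k - s : ℕ) : ℝ))
    (ht : 32 * Real.sqrt (k - s : ℕ) ≤ (2 : ℝ) ^ n) :
    1 - ((n : ℝ≥0∞) ^ 3 * 2⁻¹ ^ ((k - 1) / 2) + ENNReal.ofReal (errBound(n, k, s))) ≤
      (plantedCliqueJoint n k).toOuterMeasure
        {p | decodeVertexSet n (AKSProg.output s (n, encodeEdgeVec p.2)) = p.1} := by
  have h1 : (plantedCliqueJoint n k).toOuterMeasure Set.univ = 1 :=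
    (PMF.toOuterMeasure_apply_eq_one_iff _ _).2 (Set.subset_univ _)
  have hunion : (Set.univ : Set (Finset (Fin n) × EdgeVec n)) =
      {p | decodeVertexSet n (AKSProg.output s (n, encodeEdgeVec p.2)) = p.1} ∪
        {p | decodeVertexSet n (AKSProg.output s (n, encodeEdgeVec p.2)) ≠ p.1} := by
    ext p; simp only [Set.mem_univ, Set.mem_union, Set.mem_setOf_eq, true_iff]; exact em _
  refine tsub_le_iff_right.2 ?_
  calc (1 : ℝ≥0∞) = (plantedCliqueJoint n k).toOuterMeasure Set.univ := h1.symm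
    _ ≤ (plantedCliqueJoint n k).toOuterMeasure
          {p | decodeVertexSet n (AKSProg.output s (n, encodeEdgeVec p.2)) = p.1} +
        (plantedCliqueJoint n k).toOuterMeasure
          {p | decodeVertexSet n (AKSProg.output s (n, encodeEdgeVec p.2)) ≠ p.1} := by
        rw [hunion]; exact MeasureTheory.measure_union_le _ _
    _ ≤ _ := by gcongr; exact toOuterMeasure_fail_le hsk hn hkn hnum ht


/-! ### Elementary growth facts -/

/-- `8 n ≤ 2ⁿ` for `n ≥ 6`. [folklore] -/
theorem eight_mul_le_two_pow {n : ℕ} (hn : 6 ≤ n) : 8 * n ≤ 2 ^ n := by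
  induction n, hn using Nat.le_induction with
  | base => norm_num
  | succ m hm ih =>
    calc 8 * (m + 1) ≤ 8 * m + 8 * m := by omega
      _ ≤ 2 ^ m + 2 ^ m := Nat.add_le_add ih ih
      _ = 2 ^ (m + 1) := by ring

/-- `32 √n ≤ 2ⁿ` for `n ≥ 16`. [folklore] -/
theorem thirtytwo_mul_sqrt_le_two_pow {n : ℕ} (hn : 16 ≤ n) : 32 * Real.sqrt n ≤ (2 : ℝ) ^ n := by
  have hsq : Real.sqrt n ≤ n / 4 := by
    rw [Real.sqrt_le_left (by positivity)]
    have : (16 : ℝ) ≤ n := by exact_mod_cast hn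
    nlinarith
  have h8 : (8 * n : ℝ) ≤ (2 : ℝ) ^ n := by exact_mod_cast eight_mul_le_two_pow (by omega)
  linarith

/-! ### The numeric side conditions hold eventually -/

/-- **The side conditions of the analysis hold for all large `n`, uniformly in `k ∈ [c√n, n]`**:
with `s = 2j` and `5000/c ≤ 2ʲ`, eventually `s + 1 ≤ k`, `64 (12 √((k-s) + 2n/2ˢ) + 1) ≤ k - s`
and `32 √(k - s) ≤ 2ⁿ`. [cite: AlonKrivelevichSudakov1998, §2.3 ("By our choice of `s`, `k - s ≥ 10 √|N*(S)|`")] -/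
theorem numeric_eventually {c : ℝ} (hc : 0 < c) {j : ℕ} (hj : 5000 / c ≤ (2 : ℝ) ^ j) :
    ∀ᶠ n : ℕ in atTop, ∀ k : ℕ, c * Real.sqrt n ≤ k → k ≤ n →
      2 * j + 1 ≤ k ∧
      64 * (12 * Real.sqrt ((k - 2 * j : ℕ) + 2 * n / 2 ^ (2 * j)) + 1) ≤ ((k - 2 * j : ℕ) : ℝ) ∧
      32 * Real.sqrt (k - 2 * j : ℕ) ≤ (2 : ℝ) ^ n := by
  set s : ℕ := 2 * j with hs
  have hlim : Tendsto (fun n : ℕ => c * Real.sqrt n) atTop atTop :=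
    (Real.tendsto_sqrt_atTop.comp tendsto_natCast_atTop_atTop).const_mul_atTop hc
  have h1 : ∀ᶠ n : ℕ in atTop, (2 * 10 ^ 6 + 2 * s + 200 : ℝ) ≤ c * Real.sqrt n :=
    hlim.eventually (eventually_ge_atTop _)
  have h2 : ∀ᶠ n : ℕ in atTop, 16 ≤ n := eventually_ge_atTop 16
  filter_upwards [h1, h2] with n hn1 hn16 k hck hkn
  have hk0 : (2 * 10 ^ 6 + 2 * s + 200 : ℝ) ≤ k := hn1.trans hck
  have hsk : s + 1 ≤ k := by
    have : (s + 1 : ℝ) ≤ k := by linarith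
    exact_mod_cast this
  have hcast : ((k - s : ℕ) : ℝ) = k - s := by push_cast [Nat.cast_sub (by omega : s ≤ k)]; ring
  refine ⟨hsk, ?_, ?_⟩
  · -- the main condition, by cases on `κ` versus `4a`
    rw [hcast]
    set κ : ℝ := k - s with hκ
    set a : ℝ := 2 * n / 2 ^ s with ha
    have ha0 : 0 ≤ a := by positivity
    have hκbig : 10 ^ 6 + s + 200 ≤ κ := by rw [hκ]; linarith
    have hκpos : 0 < κ := by linarith
    rcases le_or_gt (4 * a) κ with hA | hB
    · -- Case A: `√(κ + a) ≤ √(5κ/4)` and `κ ≥ 10⁶`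
      have hroot : Real.sqrt (κ + a) ≤ Real.sqrt 5 / 2 * Real.sqrt κ := by
        rw [show Real.sqrt 5 / 2 * Real.sqrt κ = Real.sqrt (5 / 4 * κ) by
          rw [Real.sqrt_mul (by norm_num), show (5 / 4 : ℝ) = 5 / 2 ^ 2 by norm_num,
            Real.sqrt_div' _ (by norm_num), Real.sqrt_sq (by norm_num)]]
        exact Real.sqrt_le_sqrt (by linarith)
      have h5 : Real.sqrt 5 ≤ 2.237 := by
        rw [Real.sqrt_le_left (by norm_num)]; norm_num
      have hsqκ : 1000 ≤ Real.sqrt κ := by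
        rw [show (1000 : ℝ) = Real.sqrt (1000 ^ 2) by rw [Real.sqrt_sq (by norm_num)]]
        exact Real.sqrt_le_sqrt (by linarith)
      have hκsq : κ = Real.sqrt κ * Real.sqrt κ := (Real.mul_self_sqrt hκpos.le).symm
      nlinarith [Real.sqrt_nonneg κ, Real.sqrt_nonneg (κ + a)]
    · -- Case B: `κ + a < 5a = 10 n / 4ʲ`, and `2ʲ ≥ 5000/c`
      have hroot : Real.sqrt (κ + a) ≤ Real.sqrt 10 * Real.sqrt n / 2 ^ j := by
        have h5a : κ + a ≤ 10 * n / (2 ^ j) ^ 2 := by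
          have : (2 : ℝ) ^ s = (2 ^ j) ^ 2 := by rw [hs, mul_comm, pow_mul]
          rw [ha, this] at hB ⊢
          have h10 : (10 : ℝ) * n / (2 ^ j) ^ 2 = 5 * (2 * n / (2 ^ j) ^ 2) := by ring
          rw [h10]
          linarith
        calc Real.sqrt (κ + a) ≤ Real.sqrt (10 * n / (2 ^ j) ^ 2) := Real.sqrt_le_sqrt h5a
          _ = Real.sqrt 10 * Real.sqrt n / 2 ^ j := by
              rw [Real.sqrt_div' _ (by positivity), Real.sqrt_sq (by positivity),
                Real.sqrt_mul (by norm_num)]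
      have h10 : Real.sqrt 10 ≤ 3.163 := by
        rw [Real.sqrt_le_left (by norm_num)]; norm_num
      have hjinv : Real.sqrt n / 2 ^ j ≤ c * Real.sqrt n / 5000 := by
        have h5000 : (5000 : ℝ) ≤ c * 2 ^ j := (div_le_iff₀' hc).1 hj
        rw [div_le_div_iff₀ (by positivity) (by norm_num)]
        calc Real.sqrt n * 5000 ≤ Real.sqrt n * (c * 2 ^ j) := by gcongr
          _ = c * Real.sqrt n * 2 ^ j := by ring
      have hkey : 768 * Real.sqrt (κ + a) ≤ 0.486 * (c * Real.sqrt n) := by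
        calc 768 * Real.sqrt (κ + a) ≤ 768 * (Real.sqrt 10 * (Real.sqrt n / 2 ^ j)) := by
              rw [mul_div_assoc] at hroot; gcongr
          _ ≤ 768 * (3.163 * (c * Real.sqrt n / 5000)) := by gcongr
          _ ≤ 0.486 * (c * Real.sqrt n) := by nlinarith [mul_nonneg hc.le (Real.sqrt_nonneg n)]
      have hκlow : c * Real.sqrt n - s ≤ κ := by rw [hκ]; linarith
      nlinarith [mul_nonneg hc.le (Real.sqrt_nonneg n)]
  · -- `32 √(k - s) ≤ 32 √n ≤ 2ⁿ`
    calc 32 * Real.sqrt (k - s : ℕ) ≤ 32 * Real.sqrt n := by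
          gcongr; exact_mod_cast (Nat.sub_le k s).trans hkn
      _ ≤ (2 : ℝ) ^ n := thirtytwo_mul_sqrt_le_two_pow hn16

/-! ### The error terms tend to zero -/

/-- **`errBound(n, k n, s) → 0`** in the regime `c √n ≤ k n`. [folklore] -/
theorem tendsto_errBound {c : ℝ} (hc : 0 < c) (s : ℕ) {k : ℕ → ℕ}
    (hk : ∀ᶠ n : ℕ in atTop, c * Real.sqrt n ≤ k n ∧ k n ≤ n) :
    Tendsto (fun n => errBound(n, k n, s)) atTop (𝓝 0) := by
  -- eventually `s ≤ k n`, so `κ = k n - s ≥ c√n - s` as reals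
  have hlim : Tendsto (fun n : ℕ => c * Real.sqrt n) atTop atTop :=
    (Real.tendsto_sqrt_atTop.comp tendsto_natCast_atTop_atTop).const_mul_atTop hc
  have hs : ∀ᶠ n : ℕ in atTop, (s : ℝ) ≤ c * Real.sqrt n := hlim.eventually (eventually_ge_atTop _)
  have hn1 : ∀ᶠ n : ℕ in atTop, 1 ≤ n := eventually_ge_atTop 1
  -- the comparison bound
  set g : ℕ → ℝ := fun n =>
    Real.exp (s / 72) * (2 * (n : ℝ) ^ 3 * Real.exp (-(c / 72) * Real.sqrt n)) +
    Real.exp (4 * s) * (2 * (n : ℝ) ^ 3 * Real.exp (-(4 * c) * Real.sqrt n)) + 2 ^ s / n with hg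
  have hglim : Tendsto g atTop (𝓝 0) := by
    have h1 := (tendsto_cube_mul_exp_neg_sqrt (b := c / 72) (by positivity)).const_mul (Real.exp (s / 72))
    have h2 := (tendsto_cube_mul_exp_neg_sqrt (b := 4 * c) (by positivity)).const_mul (Real.exp (4 * s))
    have h3 : Tendsto (fun n : ℕ => (2 : ℝ) ^ s / n) atTop (𝓝 0) :=
      tendsto_const_div_atTop_nhds_zero_nat _
    rw [mul_zero] at h1 h2
    simpa [hg] using (h1.add h2).add h3
  refine squeeze_zero' (Eventually.of_forall fun n => errBound_nonneg n (k n) s) ?_ hglim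
  filter_upwards [hk, hs, hn1] with n hkn hsn hn
  have hsk : s ≤ k n := by
    have : (s : ℝ) ≤ k n := hsn.trans hkn.1
    exact_mod_cast this
  have hκ : c * Real.sqrt n - s ≤ ((k n - s : ℕ) : ℝ) := by
    rw [Nat.cast_sub hsk]; linarith [hkn.1]
  have hn1' : (1 : ℝ) ≤ n := by exact_mod_cast hn
  have hn3 : (n : ℝ) ≤ 2 * (n : ℝ) ^ 3 := by
    have hnn : (1 : ℝ) ≤ n * n := one_le_mul_of_one_le_of_one_le hn1' hn1'
    nlinarith [mul_le_mul_of_nonneg_left hnn (Nat.cast_nonneg n)]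
  have hone3 : (1 : ℝ) ≤ 2 * (n : ℝ) ^ 3 := hn1'.trans hn3
  change _ ≤ Real.exp (s / 72) * (2 * (n : ℝ) ^ 3 * Real.exp (-(c / 72) * Real.sqrt n)) +
    Real.exp (4 * s) * (2 * (n : ℝ) ^ 3 * Real.exp (-(4 * c) * Real.sqrt n)) + 2 ^ s / n
  gcongr ?_ + ?_ + _
  · -- `n e^{-κ/72} ≤ e^{s/72} (2n³ e^{-(c/72)√n})`
    calc (n : ℝ) * Real.exp (-(((k n - s : ℕ) : ℝ) / 72))
        ≤ (2 * (n : ℝ) ^ 3) * Real.exp (s / 72 + -(c / 72) * Real.sqrt n) :=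
          mul_le_mul hn3 (Real.exp_le_exp.2 (by linarith)) (by positivity) (by positivity)
      _ = _ := by rw [Real.exp_add]; ring
  · -- `e^{-4κ} ≤ e^{4s} (2n³ e^{-4c√n})`
    calc Real.exp (-(4 * ((k n - s : ℕ) : ℝ)))
        ≤ 1 * Real.exp (4 * s + -(4 * c) * Real.sqrt n) := by
          rw [one_mul]; exact Real.exp_le_exp.2 (by linarith)
      _ ≤ (2 * (n : ℝ) ^ 3) * Real.exp (4 * s + -(4 * c) * Real.sqrt n) := by gcongr
      _ = _ := by rw [Real.exp_add]; ring

/-! ### Success with probability tending to one -/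

/-- **The AKS program succeeds almost surely.** For `c > 0`, `5000/c ≤ 2ʲ` and a clique-size
sequence with `c √n ≤ k n ≤ n` eventually, the probability under `G(n, 1/2, k n)` that
`AKSProg.output (2j)` returns the planted set tends to `1`.
[cite: AlonKrivelevichSudakov1998, §2.3 (correctness of Algorithm B) with §1 (main result)] -/
theorem tendsto_success {c : ℝ} (hc : 0 < c) {j : ℕ} (hj : 5000 / c ≤ (2 : ℝ) ^ j) {k : ℕ → ℕ}
    (hk : ∀ᶠ n : ℕ in atTop, c * Real.sqrt n ≤ k n ∧ k n ≤ n) :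
    Tendsto (fun n => (plantedCliqueJoint n (k n)).toOuterMeasure
      {p | decodeVertexSet n (AKSProg.output (2 * j) (n, encodeEdgeVec p.2)) = p.1}) atTop (𝓝 1) := by
  set s : ℕ := 2 * j with hs
  -- the error term and its limit
  set ε : ℕ → ℝ≥0∞ := fun n => (n : ℝ≥0∞) ^ 3 * 2⁻¹ ^ ((k n - 1) / 2) +
    ENNReal.ofReal (errBound(n, k n, s)) with hε
  have hreal1 : Tendsto (fun n : ℕ => (n : ℝ) ^ 3 * 2⁻¹ ^ ((k n - 1) / 2)) atTop (𝓝 0) := by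
    refine squeeze_zero' (Eventually.of_forall fun n => by positivity) ?_
      (tendsto_cube_mul_exp_neg_sqrt (b := c * Real.log 2 / 2)
        (by have := Real.log_pos one_lt_two; positivity))
    filter_upwards [hk] with n hn
    exact cube_mul_half_pow_le hn.1
  have hε1 : ∀ n : ℕ, (n : ℝ≥0∞) ^ 3 * 2⁻¹ ^ ((k n - 1) / 2) =
      ENNReal.ofReal ((n : ℝ) ^ 3 * 2⁻¹ ^ ((k n - 1) / 2)) := by
    intro n
    rw [ENNReal.ofReal_mul (by positivity), ENNReal.ofReal_pow (Nat.cast_nonneg _),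
      ENNReal.ofReal_natCast, ENNReal.ofReal_pow (by norm_num),
      ENNReal.ofReal_inv_of_pos two_pos, ENNReal.ofReal_ofNat]
  have hεlim : Tendsto ε atTop (𝓝 0) := by
    have h1 := ENNReal.tendsto_ofReal hreal1
    have h2 := ENNReal.tendsto_ofReal (tendsto_errBound hc s hk)
    rw [ENNReal.ofReal_zero] at h1 h2
    have h := h1.add h2
    rw [add_zero] at h
    refine h.congr fun n => ?_
    simp only [hε]
    rw [hε1]
  -- squeeze between `1 - ε n` and `1`
  have hlow : Tendsto (fun n => 1 - ε n) atTop (𝓝 1) := by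
    have h := ENNReal.Tendsto.sub (tendsto_const_nhds (x := (1 : ℝ≥0∞))) hεlim
      (Or.inl ENNReal.one_ne_top)
    rwa [tsub_zero] at h
  have hnum := numeric_eventually hc hj
  have hn1 : ∀ᶠ n : ℕ in atTop, 1 ≤ n := eventually_ge_atTop 1
  refine tendsto_of_tendsto_of_tendsto_of_le_of_le' hlow tendsto_const_nhds ?_
    (Eventually.of_forall fun n => ?_)
  · filter_upwards [hk, hnum, hn1] with n hkn hnumn hn
    obtain ⟨hsk, hmain, ht⟩ := hnumn (k n) hkn.1 hkn.2
    exact one_sub_le_toOuterMeasure_success hsk hn hkn.2 hmain ht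
  · refine le_trans ((plantedCliqueJoint n (k n)).toOuterMeasure.mono (Set.subset_univ _)) ?_
    exact ((PMF.toOuterMeasure_apply_eq_one_iff _ _).2 (Set.subset_univ _)).le

end Literature.Probability.RandomGraphs.PlantedClique

end
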